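import Mathlib
import Literature.MathematicalPhysics.StatisticalMechanics.Crystallization
import Literature.MathematicalPhysics.StatisticalMechanics.MuGroundStateConfiguration
import Literature.MathematicalPhysics.StatisticalMechanics.LocalLimitOfGroundStates
import Summits.AtomisticToContinuum.Crystallization.Theses.ChessboardParticlePlanes

/-!
# Sketch — crux-ideate stmt-AtomisticToContinuum-3240 (PeriodicWindows), ideator 2, round 1

First lemmas of the two idea cards (`idea-mirror-saturation-rp-zero-set.md`,
`idea-bisect-and-reflect.md`), stated over existing declarations. Nothing is proved here; every
`def … : Prop` must elaborate (`lean check` rc 0).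
-/

noncomputable section

open scoped BigOperators
open Classical
open Literature.MathematicalPhysics.StatisticalMechanics

namespace Summit.AtomisticToContinuum.Crystallization.Cruxes.PeriodicWindows.IdeatorTwo

/-- Euclidean 3-space. -/
abbrev E3 := EuclideanSpace ℝ (Fin 3)

/-- The vertical unit vector `e₃`. -/
def e3 : E3 := EuclideanSpace.single (2 : Fin 3) (1 : ℝ)

/-- Reflection through the horizontal plane `{z = t}`. -/
def reflectZ (t : ℝ) (p : E3) : E3 := p - (2 * (p 2 - t)) • e3

/-! ## Card A — mirror saturation by the RP zero set + recurrence -/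

/-- **Card A, first lemma (pure geometry, provable now).** A laminar point set (all points on the
horizontal planes `z = t n`, every plane occupied, heights strictly increasing in `n : ℤ`) that is
mirror-symmetric about EVERY occupied plane is a period-2 stack: the spacings are all equal to one
`c > 0` and the set is invariant under the vertical translations `± 2c e₃`. (Proof: the mirror at
plane `n` is an order-reversing bijection of the occupied heights fixing `t n`, so it maps the
successor height to the predecessor height: `t (n+1) - t n = t n - t (n-1)`; and
`reflectZ (t (n+1)) ∘ reflectZ (t n)` is the translation by `2c e₃`.) -/
def MirrorSaturatedIsPeriodTwo : Prop :=
  ∀ (X : Set E3) (t : ℤ → ℝ), StrictMono t →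
    (∀ x ∈ X, ∃ n : ℤ, x 2 = t n) → (∀ n : ℤ, ∃ x ∈ X, x 2 = t n) →
    (∀ n : ℤ, ∀ x ∈ X, reflectZ (t n) x ∈ X) →
    ∃ c : ℝ, 0 < c ∧ (∀ n : ℤ, t (n + 1) - t n = c) ∧
      ∀ x ∈ X, x + (2 * c) • e3 ∈ X ∧ x - (2 * c) • e3 ∈ X

/-- **Glue (provable now).** A non-empty uniformly discrete subset of `ℝ³` invariant under three
linearly independent translations is the point set of a `PeriodicConfiguration 3` (lattice of
periods `ℤv₀+ℤv₁+ℤv₂`, motif = representatives in a fundamental cell, finite by discreteness). -/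
def PeriodicOfThreeTranslations : Prop :=
  ∀ X : Set E3, X.Nonempty → UniformlyDiscrete X →
    ∀ v : Fin 3 → E3, LinearIndependent ℝ v →
      (∀ i, ∀ x ∈ X, x + v i ∈ X ∧ x - v i ∈ X) →
      ∃ P : PeriodicConfiguration 3, P.points = X

/-- Lennard-Jones energy of a finite point SET (each unordered pair once). -/
def fsEnergy (S : Finset E3) : ℝ :=
  (1 / 2) * ∑ p ∈ S, ∑ q ∈ S.erase p, lennardJones (dist p q)

/-- Left mirror-double of `S` through the plane `z = t`: the closed lower half of `S` together with
the mirror image of its open lower half. -/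
def leftDouble (t : ℝ) (S : Finset E3) : Finset E3 :=
  (S.filter fun p => p 2 ≤ t) ∪ ((S.filter fun p => p 2 < t).image (reflectZ t))

/-- Right mirror-double of `S` through the plane `z = t`. -/
def rightDouble (t : ℝ) (S : Finset E3) : Finset E3 :=
  (S.filter fun p => t ≤ p 2) ∪ ((S.filter fun p => t < p 2).image (reflectZ t))

/-- The reflection-positivity DEFICIT of `S` at the plane `z = t`:
`E(S) − ½[E(S^{LL}) + E(S^{RR})]`. For an RP cross-plane kernel this is `½‖μ_L − θμ_R‖²` in the
RP inner product, hence `≥ 0` with equality iff `S` is mirror-symmetric about the plane. -/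
def rpDeficit (t : ℝ) (S : Finset E3) : ℝ :=
  fsEnergy S - (fsEnergy (leftDouble t S) + fsEnergy (rightDouble t S)) / 2

/-- **The analytic input shared by both cards (= the single-reflection form of crux
`LjPlaneChessboard`, stmt-6709): RP step across a clean slab.** For a `2/3`-separated finite
configuration all of whose points lie ON the plane `z = t` or at distance `≥ 3/4` from it, the
deficit is non-negative. (The completely monotone part of each in-plane mode of `−r⁻⁶` across the
plane is exactly RP; the bet is that the anti-RP `r⁻¹²` remainder — in-plane modes `|q| ≳ 12.35` at
cross separation `3/2` — is dominated on the separated class; on the Barlow/triangular-layer class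
only reciprocal-lattice modes enter and the margin is ~10³.) -/
def RPStep : Prop :=
  ∀ (S : Finset E3) (t : ℝ),
    (∀ p ∈ S, ∀ q ∈ S, p ≠ q → (2 : ℝ) / 3 ≤ dist p q) →
    (∀ p ∈ S, p 2 = t ∨ (3 : ℝ) / 4 ≤ |p 2 - t|) →
    0 ≤ rpDeficit t S

/-- Local mirror ASYMMETRY witness: the patch of `X` in the ball of radius `ρ` about the point `p`
(which lies on the plane `z = p 2`) is NOT two-way `η`-matched with its own mirror image through
that plane. -/
def MirrorBad (η ρ : ℝ) (X : Set E3) (p : E3) : Prop :=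
  ¬ BallMatch η ρ p X (reflectZ (p 2) '' X)

/-- Uniform recurrence (almost periodicity) of a point set in the local matching topology: every
patch recurs, up to `ε`, within distance `M(R, ε)` of every point of space. -/
def UniformlyRecurrent (X : Set E3) : Prop :=
  ∀ R ε : ℝ, 0 < ε → ∃ M : ℝ, ∀ c d : E3, ∃ s : E3, dist s d ≤ M ∧
    BallMatch ε R 0 ((fun p => p - c) '' X) ((fun p => p - s) '' X)

/-- **Card A, the lever's conclusion (target of the future skeleton; hypotheses abbreviated to the
typed ones).** `RPStep` implies: every uniformly recurrent, laminar (occupied heights `t n`,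
pairwise `≥ 3/4` apart), `2/3`-separated local limit of Lennard-Jones ground states is mirror
saturated — no patch is mirror-bad at any tolerance. (Mechanism: otherwise mirror-bad planes recur
with bounded gaps `G`; a GLL chessboard whose cuts are CHOSEN at mirror-bad planes accumulates a
deficit DENSITY `≥ c(η,ρ)/G > 0`, while `e(X) = e*` (sub-cluster pinning) and every period-2
restack has `e ≥ e*` (definition of `e*`) leave deficit density `0`.) With
`MirrorSaturatedIsPeriodTwo` the limit is an exact period-2 stack of constant spacing. -/
def MirrorSaturation : Prop :=
  RPStep →
    ∀ X : Set E3, IsLocalLimitOfGroundStates lennardJones 3 X → UniformlyRecurrent X →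
      (∀ x ∈ X, ∀ y ∈ X, x ≠ y → (2 : ℝ) / 3 ≤ dist x y) →
      (∃ t : ℤ → ℝ, StrictMono t ∧ (∀ n, (3 : ℝ) / 4 ≤ t (n + 1) - t n) ∧
        (∀ x ∈ X, ∃ n, x 2 = t n) ∧ (∀ n, ∃ x ∈ X, x 2 = t n)) →
      ∀ η ρ : ℝ, 0 < η → ∀ p ∈ X, ¬ MirrorBad η ρ X p

/-- **Glue (provable now, diagonal argument as in
`IsLocalLimitOfGroundStates.of_eventually_ballMatch`).** If `X` is a local limit of THE GIVEN
ground-state sequence `x` and a periodic configuration `P` lies in the hull of `X` (every ball of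
`P.points` is `ε`-matched by a translate of `X`), then `x` has periodic windows on `P` — literally
the conclusion of `PeriodicWindows` for this `x` with this `P`. -/
def PeriodicHullPointGivesWindows : Prop :=
  ∀ x : (N : ℕ) → (Fin N → E3), (∀ N, IsGroundState lennardJones (x N)) →
    ∀ X : Set E3,
      (∃ (σ : ℕ → ℕ) (τ : ℕ → E3), StrictMono σ ∧ ∀ R ε : ℝ, 0 < ε →
        ∀ᶠ j in Filter.atTop, BallMatch ε R 0 (Set.range fun i => x (σ j) i + τ j) X) →
      ∀ P : PeriodicConfiguration 3,
        (∀ R ε : ℝ, 0 < ε → ∃ s : E3, BallMatch ε R 0 ((fun p => p + s) '' X) P.points) →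
        ∀ R ε : ℝ, 0 < ε → ∃ᶠ N in Filter.atTop, ∃ t : E3,
          (∀ s ∈ P.points, ‖s‖ ≤ R → ∃ i : Fin N, dist (x N i + t) s ≤ ε) ∧
          (∀ i : Fin N, ‖x N i + t‖ ≤ R → ∃ s ∈ P.points, dist (x N i + t) s ≤ ε)

/-! ## Card B — bisect and reflect (finite N) -/

/-- The surface term `f(N) = E(N) − e* N` of the Lennard-Jones ground-state energy in `ℝ³`
(`e*` = infimum of the energy per particle over periodic configurations; `E(N)/N → e*` is the
PROVED item `CrysEnergyLimit`, stmt-0626). -/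
def surfaceTerm (N : ℕ) : ℝ :=
  groundStateEnergy lennardJones 3 N -
    (⨅ Q : PeriodicConfiguration 3, Q.energyPerParticle lennardJones) * N

/-- **Card B, first lemma — free surface regularity (provable now).** From `0 ≤ f(N)`
(Fekete: `e* = inf E(N)/N`, by `subadditive_groundStateEnergy_lennardJones` + `CrysEnergyLimit`),
`f(N) = o(N)` (`CrysEnergyLimit`, PROVED) and subadditivity `f(N+m) ≤ f(N) + f(m)` ALONE: for
every `ε, k, θ > 0` and all large `M`, the integers `N ∈ [M, 2M]` at which the midpoint defect of
`f` at some increment `Δ ≤ k N^{2/3}` exceeds `ε N^{2/3}` number at most `θ M` (a maximal chain of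
forward drops `> ε N^{2/3}` has `≤ (ε'/ε)·O(M^{1/3}) + O(1)` links when `f(m) ≤ ε' m + C_{ε'}`, each
link covering `≤ k (2M)^{2/3}` integers; backward terms are controlled by `f(N−Δ) ≥ f(N) − f(Δ)`).
With the sharper (unproved, expected) bound `f ≤ C N^{2/3}` the count improves to `O_{ε,k}(M^{2/3})`.
Either way the exceptional set has density zero. -/
def SurfaceMidpointRegular : Prop :=
  ∀ ε k θ : ℝ, 0 < ε → 0 < k → 0 < θ → ∃ M₀ : ℕ, ∀ M : ℕ, M₀ ≤ M →
    (Nat.card {N : ℕ // M ≤ N ∧ N ≤ 2 * M ∧ ∃ Δ : ℕ, Δ ≤ N ∧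
        (Δ : ℝ) ≤ k * (N : ℝ) ^ ((2 : ℝ) / 3) ∧
        ε * (N : ℝ) ^ ((2 : ℝ) / 3) <
          surfaceTerm N - (surfaceTerm (N + Δ) + surfaceTerm (N - Δ)) / 2} : ℝ)
      ≤ θ * (M : ℝ)

/-- **Card B, the lever (bookkeeping, provable now): bisect and reflect.** For a ground state `x`
of `N` particles and a particle plane `z = t` with a clean slab (every particle on the plane or at
distance `≥ 3/4` from it), the RP deficit of the WHOLE cluster at that plane is paid by the
midpoint-concavity defect of the surface term at the particle numbers of the two mirror-doubles
(`E(S^{LL}) ≥ E(#S^{LL})`, `E(S^{RR}) ≥ E(#S^{RR})`, and `#S^{LL} + #S^{RR} = 2N`, so the `e*`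
parts cancel). With `SurfaceMidpointRegular` and a near-bisecting plane (`|#S^{LL} − N| = O(N^{2/3})`)
the deficit is `o(N^{2/3}) = o(area)` for density-one `N`. -/
def BisectAndReflect : Prop :=
  ∀ (N : ℕ) (x : Fin N → E3), IsGroundState lennardJones x → ∀ t : ℝ,
    (∀ i, x i 2 = t ∨ (3 : ℝ) / 4 ≤ |x i 2 - t|) →
    rpDeficit t (Finset.univ.image x) ≤
      surfaceTerm N -
        (surfaceTerm (leftDouble t (Finset.univ.image x)).card +
          surfaceTerm (rightDouble t (Finset.univ.image x)).card) / 2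

/-- Sanity: the crux decl this chain must conclude, by name. -/
example : Prop := Summit.AtomisticToContinuum.Crystallization.Theses.ChessboardParticlePlanes.PeriodicWindows

end Summit.AtomisticToContinuum.Crystallization.Cruxes.PeriodicWindows.IdeatorTwo

end
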